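import Summits.KontsevichZagierPeriods.KontsevichZagierPeriods.Theorems.MultiplicationAccessible.Negative.Core
import Summits.KontsevichZagierPeriods.KontsevichZagierPeriods.Theorems.MultiplicationThree.Negative.Pinned
import Literature.NumberTheory.Transcendental.KZProductIdeal
import Literature.NumberTheory.Transcendental.FischlerRivoalCorollary1Reduction

/-!
# `MultiplicationAccessible` (stmt-KontsevichZagierPeriods-12305), line `shifted-family-prime-sieve`,
stub `stub_multiplicativityGlue` — helper API, part 1: Beta boxes, their equivalence, permutations

A *Beta box* is the integral representation `[(0,1)^N, κ ∏ᵢ zᵢ^(αᵢ−1)(1−zᵢ)^(βᵢ−1)]` attached to a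
real algebraic constant `κ` and two exponent vectors `α β : Fin N → ℚ` with positive entries; its
integrand is written out in full everywhere below as
`fun z => κ * ∏ i, (z i ^ ((α i : ℝ) − 1) * (1 − z i) ^ ((β i : ℝ) − 1))`.
Two box functions `F`, `G` are *equivalent* when some box representative of `F` (a
`KZ.IntegralRep` with domain `boxDom _` and integrand `F` on it) is `KZ.Equivalent` to some box
representative of `G`; this relation is also written out in full (no definitions are introduced).
This file proves:

* `exists_betaRep` — Beta boxes exist (semialgebraic by `KZ.isSemialgebraicFunOn_mellinIntegrand`,
  integrable as a product of Beta kernels);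
* `equivalent_of_equiv` — representative independence (congruence), and the groupoid structure
  `equiv_symm`, `equiv_trans`, `equiv_of_eqOn` of the equivalence of box functions;
* `equiv_reindex` / `beta_perm` — permuting coordinates is a move
  (`KZ.of_sub_of_reindex_mem_relations`).
-/

noncomputable section

open MeasureTheory Set Real
open scoped BigOperators

namespace Summit.KontsevichZagierPeriods.TerasomaMultiplication.MultiplicationAccessible.MultGlue

open Literature.NumberTheory.Transcendental
open Literature.NumberTheory.Transcendental.KZ
open Literature.ModelTheory.ExponentialFields (IsSemialgebraic)
open MvPolynomial (X)
open Summit.KontsevichZagierPeriods.MultiplicationAccessible.Negative (boxDom isSemialgebraic_boxDom)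
open Summit.KontsevichZagierPeriods.TerasomaMultiplication.MultiplicationThreeNegative
  (integrableOn_beta)

/-! ## Existence of Beta boxes -/

/-- The Gauss-multiplication constant `(a+1)^((a+1)s)` is real algebraic for rational `s`.
[folklore] -/
theorem isAlgebraic_gaussConst (a : ℕ) (s : ℚ) :
    IsAlgebraic ℚ (((a:ℝ) + 1) ^ (((a:ℝ) + 1) * (s:ℝ))) := by
  have h1 : IsAlgebraic ℚ ((a:ℝ) + 1) := by
    have := isAlgebraic_nat (R := ℚ) (A := ℝ) (a + 1)
    push_cast at this
    exact this
  have h2 : ((a:ℝ) + 1) * (s:ℝ) = (((((a:ℚ) + 1) * s : ℚ)) : ℝ) := by push_cast; ring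
  rw [h2]
  exact isAlgebraic_rpow_ratCast h1 (by positivity) _

/-- Lebesgue measure restricted to the box `(0,1)^N` is the product of the restricted
one-dimensional measures. [folklore] -/
theorem volume_restrict_boxDom (N : ℕ) :
    (volume : Measure (Fin N → ℝ)).restrict (boxDom N) =
      Measure.pi fun _ : Fin N => (volume : Measure ℝ).restrict (Ioo (0:ℝ) 1) := by
  have : boxDom N = Set.pi Set.univ fun _ : Fin N => Ioo (0:ℝ) 1 := by
    ext x; simp [boxDom]
  rw [this, volume_pi, Measure.restrict_pi_pi]

/-- The pure Beta product `∏ᵢ zᵢ^(αᵢ−1)(1−zᵢ)^(βᵢ−1)` with rational exponents is `ℚ`-semialgebraic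
on the box (it is an Euler–Mellin integrand). [folklore] -/
theorem isSemialgebraicFunOn_betaProd {N : ℕ} (α β : Fin N → ℚ) :
    IsSemialgebraicFunOn ℚ (boxDom N)
      (fun z : Fin N → ℝ => ∏ i, ((z i) ^ (((α i : ℚ) : ℝ) - 1) *
        (1 - z i) ^ (((β i : ℚ) : ℝ) - 1))) := by
  refine (isSemialgebraicFunOn_mellinIntegrand (isSemialgebraic_boxDom N)
    (Fin.append (fun i => (X i : MvPolynomial (Fin N) ℚ)) (fun i => 1 - X i))
    (Fin.append (fun i => α i - 1) (fun i => β i - 1)) 1 ?_).congr ?_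
  · intro x hx k
    induction k using Fin.addCases with
    | left i => simpa [Fin.append_left] using (hx i).1
    | right i =>
      rw [Fin.append_right]
      simpa [sub_pos] using (hx i).2
  · intro x _
    simp only [mellinIntegrand, Fin.prod_univ_add, Fin.append_left, Fin.append_right,
      Rat.cast_one, one_mul, map_sub, map_one, MvPolynomial.aeval_X, Rat.cast_sub]
    rw [← Finset.prod_mul_distrib]

/-- **Beta boxes exist**: for a real algebraic constant `κ` and positive rational exponent vectors
`α, β` there is an integral representation with domain `(0,1)^N` and integrand
`κ ∏ᵢ zᵢ^(αᵢ−1)(1−zᵢ)^(βᵢ−1)`. [folklore] -/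
theorem exists_betaRep {N : ℕ} (κ : ℝ) (hκ : IsAlgebraic ℚ κ) (α β : Fin N → ℚ)
    (hα : ∀ i, 0 < α i) (hβ : ∀ i, 0 < β i) :
    ∃ r : KZ.IntegralRep N, r.domain = boxDom N ∧ Set.EqOn r.integrand (fun z : Fin _ → ℝ => κ *
        ∏ i, (z i ^ (((α i : ℚ) : ℝ) - 1) * (1 - z i) ^ (((β i : ℚ) : ℝ) - 1))) r.domain := by
  have hsf : IsSemialgebraicFunOn ℚ (boxDom N) (fun z : Fin _ → ℝ => κ *
      ∏ i, (z i ^ (((α i : ℚ) : ℝ) - 1) * (1 - z i) ^ (((β i : ℚ) : ℝ) - 1))) :=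
    IsSemialgebraicFunOn.mul_holds
      (isSemialgebraicFunOn_const_of_isAlgebraic (isSemialgebraic_boxDom N) hκ)
      (isSemialgebraicFunOn_betaProd α β)
  have hint : IntegrableOn (fun z : Fin _ → ℝ => κ *
      ∏ i, (z i ^ (((α i : ℚ) : ℝ) - 1) * (1 - z i) ^ (((β i : ℚ) : ℝ) - 1))) (boxDom N) := by
    rw [IntegrableOn, volume_restrict_boxDom]
    have h := Integrable.fintype_prod
      (f := fun (i : Fin N) (t : ℝ) => t ^ (((α i : ℚ) : ℝ) - 1) * (1 - t) ^ (((β i : ℚ) : ℝ) - 1))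
      (μ := fun _ : Fin N => (volume : Measure ℝ).restrict (Ioo (0:ℝ) 1))
      (fun i => integrableOn_beta (by exact_mod_cast hα i) (by exact_mod_cast hβ i))
    exact h.const_mul κ
  exact ⟨⟨boxDom N, _, isSemialgebraic_boxDom N, hsf, hint⟩, rfl, fun _ _ => rfl⟩

/-! ## The bundled equivalence of box functions -/

/-- Two box representatives of the same function are equivalent (congruence,
`KZ.of_sub_of_mem_relations_of_eqOn`). [folklore] -/
theorem equivalent_of_isRep {N : ℕ} {F : (Fin N → ℝ) → ℝ} {ρ r : KZ.IntegralRep N}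
    (hρ : ρ.domain = boxDom N) (hρi : Set.EqOn ρ.integrand F ρ.domain)
    (hr : r.domain = boxDom N) (hri : Set.EqOn r.integrand F r.domain) : KZ.Equivalent ρ r :=
  of_sub_of_mem_relations_of_eqOn (by rw [hr, hρ]) fun z hz => by
    rw [hρi hz, hri (by rw [hr, ← hρ]; exact hz)]

/-- **Representative independence**: if some representative of `F` is equivalent to some
representative of `G`, then every representative of `F` is equivalent to every representative of
`G`. [folklore] -/
theorem equivalent_of_equiv {N N' : ℕ} {F : (Fin N → ℝ) → ℝ} {G : (Fin N' → ℝ) → ℝ}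
    (h : (∃ (ρ₁ : KZ.IntegralRep _) (ρ₂ : KZ.IntegralRep _),
        (ρ₁.domain = boxDom _ ∧ EqOn ρ₁.integrand F ρ₁.domain) ∧
        (ρ₂.domain = boxDom _ ∧ EqOn ρ₂.integrand G ρ₂.domain) ∧
        KZ.Equivalent ρ₁ ρ₂))
    (ρ : KZ.IntegralRep N) (ρ' : KZ.IntegralRep N') (hρ : ρ.domain = boxDom N)
    (hρi : Set.EqOn ρ.integrand F ρ.domain) (hρ' : ρ'.domain = boxDom N')
    (hρ'i : Set.EqOn ρ'.integrand G ρ'.domain) : KZ.Equivalent ρ ρ' := by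
  obtain ⟨r, r', ⟨hrd, hri⟩, ⟨hr'd, hr'i⟩, hrr'⟩ := h
  exact (equivalent_of_isRep hρ hρi hrd hri).trans
    (hrr'.trans (equivalent_of_isRep hr'd hr'i hρ' hρ'i))

/-- Symmetry of the bundled equivalence. [folklore] -/
theorem equiv_symm {N N' : ℕ} {F : (Fin N → ℝ) → ℝ} {G : (Fin N' → ℝ) → ℝ}
    (h : (∃ (ρ₁ : KZ.IntegralRep _) (ρ₂ : KZ.IntegralRep _),
        (ρ₁.domain = boxDom _ ∧ EqOn ρ₁.integrand F ρ₁.domain) ∧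
        (ρ₂.domain = boxDom _ ∧ EqOn ρ₂.integrand G ρ₂.domain) ∧
        KZ.Equivalent ρ₁ ρ₂)) :
    (∃ (ρ₁ : KZ.IntegralRep _) (ρ₂ : KZ.IntegralRep _),
        (ρ₁.domain = boxDom _ ∧ EqOn ρ₁.integrand G ρ₁.domain) ∧
        (ρ₂.domain = boxDom _ ∧ EqOn ρ₂.integrand F ρ₂.domain) ∧
        KZ.Equivalent ρ₁ ρ₂) := by
  obtain ⟨r, r', hr, hr', hrr'⟩ := h
  exact ⟨r', r, hr', hr, hrr'.symm⟩

/-- Transitivity of the bundled equivalence (through congruence of the two middle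
representatives). [folklore] -/
theorem equiv_trans {N N' N'' : ℕ} {F : (Fin N → ℝ) → ℝ} {G : (Fin N' → ℝ) → ℝ}
    {H : (Fin N'' → ℝ) → ℝ}
    (h₁ : (∃ (ρ₁ : KZ.IntegralRep _) (ρ₂ : KZ.IntegralRep _),
        (ρ₁.domain = boxDom _ ∧ EqOn ρ₁.integrand F ρ₁.domain) ∧
        (ρ₂.domain = boxDom _ ∧ EqOn ρ₂.integrand G ρ₂.domain) ∧
        KZ.Equivalent ρ₁ ρ₂))
    (h₂ : (∃ (ρ₁ : KZ.IntegralRep _) (ρ₂ : KZ.IntegralRep _),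
        (ρ₁.domain = boxDom _ ∧ EqOn ρ₁.integrand G ρ₁.domain) ∧
        (ρ₂.domain = boxDom _ ∧ EqOn ρ₂.integrand H ρ₂.domain) ∧
        KZ.Equivalent ρ₁ ρ₂)) :
    (∃ (ρ₁ : KZ.IntegralRep _) (ρ₂ : KZ.IntegralRep _),
        (ρ₁.domain = boxDom _ ∧ EqOn ρ₁.integrand F ρ₁.domain) ∧
        (ρ₂.domain = boxDom _ ∧ EqOn ρ₂.integrand H ρ₂.domain) ∧
        KZ.Equivalent ρ₁ ρ₂) := by
  obtain ⟨r, r₁, hr, hr₁, e₁⟩ := h₁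
  obtain ⟨r₂, r'', hr₂, hr'', e₂⟩ := h₂
  exact ⟨r, r'', hr, hr'', e₁.trans ((equivalent_of_isRep hr₁.1 hr₁.2 hr₂.1 hr₂.2).trans e₂)⟩

/-- Reflexivity up to pointwise equality on the box: a function with a representative is
equivalent to every function agreeing with it on the box. [folklore] -/
theorem equiv_of_eqOn {N : ℕ} {F G : (Fin N → ℝ) → ℝ}
    (hex : ∃ r : KZ.IntegralRep N, r.domain = boxDom N ∧ Set.EqOn r.integrand F r.domain)
    (hFG : ∀ z ∈ boxDom N, F z = G z) :
    (∃ (ρ₁ : KZ.IntegralRep _) (ρ₂ : KZ.IntegralRep _),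
        (ρ₁.domain = boxDom _ ∧ EqOn ρ₁.integrand F ρ₁.domain) ∧
        (ρ₂.domain = boxDom _ ∧ EqOn ρ₂.integrand G ρ₂.domain) ∧
        KZ.Equivalent ρ₁ ρ₂) := by
  obtain ⟨r, hrd, hri⟩ := hex
  exact ⟨r, r, ⟨hrd, hri⟩, ⟨hrd, fun z hz => (hri hz).trans (hFG z (hrd ▸ hz))⟩,
    Equivalent.refl r⟩

/-! ## Permuting coordinates -/

/-- **Reindexing is a move**: `F` is equivalent to `w ↦ F (w ∘ e)` for every bijection of
coordinates `e` (`KZ.of_sub_of_reindex_mem_relations`). [cite: KontsevichZagier2001, §1.2] -/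
theorem equiv_reindex {N N' : ℕ} (e : Fin N ≃ Fin N') {F : (Fin N → ℝ) → ℝ}
    {G : (Fin N' → ℝ) → ℝ}
    (hex : ∃ r : KZ.IntegralRep N, r.domain = boxDom N ∧ Set.EqOn r.integrand F r.domain)
    (hG : ∀ w ∈ boxDom N', G w = F (fun i => w (e i))) :
    (∃ (ρ₁ : KZ.IntegralRep _) (ρ₂ : KZ.IntegralRep _),
        (ρ₁.domain = boxDom _ ∧ EqOn ρ₁.integrand F ρ₁.domain) ∧
        (ρ₂.domain = boxDom _ ∧ EqOn ρ₂.integrand G ρ₂.domain) ∧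
        KZ.Equivalent ρ₁ ρ₂) := by
  obtain ⟨r, hrd, hri⟩ := hex
  have hdom : (r.reindex e).domain = boxDom N' := by
    ext w
    simp only [IntegralRep.reindex_domain, hrd, boxDom, mem_setOf_eq]
    exact ⟨fun h j => by simpa using h (e.symm j), fun h i => h (e i)⟩
  refine ⟨r, r.reindex e, ⟨hrd, hri⟩, ⟨hdom, fun w hw => ?_⟩, of_sub_of_reindex_mem_relations r e⟩
  have hwb : w ∈ boxDom N' := hdom ▸ hw
  have hw' : (fun i => w (e i)) ∈ r.domain := hw
  rw [hG w hwb, IntegralRep.reindex_integrand]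
  exact hri hw'

/-- Reindexing a Beta box permutes its exponent vectors. [folklore] -/
theorem beta_perm_eq {N N' : ℕ} (e : Fin N ≃ Fin N') (κ : ℝ) (α β : Fin N → ℚ)
    (α' β' : Fin N' → ℚ) (hα : ∀ i, α' (e i) = α i) (hβ : ∀ i, β' (e i) = β i)
    (w : Fin N' → ℝ) :
    (fun z : Fin _ → ℝ => κ *
        ∏ i, (z i ^ (((α' i : ℚ) : ℝ) - 1) * (1 - z i) ^ (((β' i : ℚ) : ℝ) - 1))) w =
      (fun z : Fin _ → ℝ => κ * ∏ i,
          (z i ^ (((α i : ℚ) : ℝ) - 1) *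
            (1 - z i) ^ (((β i : ℚ) : ℝ) - 1))) (fun i => w (e i)) := by
  simp only []
  congr 1
  exact (Fintype.prod_equiv e _ _ fun i => by rw [hα i, hβ i]).symm

/-- **Permutation move for Beta boxes**: `[κ, α, β] ∼ [κ, α', β']` whenever `α' ∘ e = α` and
`β' ∘ e = β` for a bijection `e`. [cite: KontsevichZagier2001, §1.2] -/
theorem beta_perm {N N' : ℕ} (e : Fin N ≃ Fin N') {κ : ℝ} (hκ : IsAlgebraic ℚ κ)
    {α β : Fin N → ℚ} {α' β' : Fin N' → ℚ} (hαp : ∀ i, 0 < α i) (hβp : ∀ i, 0 < β i)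
    (hα : ∀ i, α' (e i) = α i) (hβ : ∀ i, β' (e i) = β i) :
    (∃ (ρ₁ : KZ.IntegralRep _) (ρ₂ : KZ.IntegralRep _),
        (ρ₁.domain = boxDom _ ∧ EqOn ρ₁.integrand
          (fun z : Fin _ → ℝ => κ *
              ∏ i, (z i ^ (((α i : ℚ) : ℝ) - 1) * (1 - z i) ^ (((β i : ℚ) : ℝ) - 1)))
          ρ₁.domain) ∧
        (ρ₂.domain = boxDom _ ∧ EqOn ρ₂.integrand
          (fun z : Fin _ → ℝ => κ *
              ∏ i, (z i ^ (((α' i : ℚ) : ℝ) - 1) * (1 - z i) ^ (((β' i : ℚ) : ℝ) - 1)))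
          ρ₂.domain) ∧
        KZ.Equivalent ρ₁ ρ₂) :=
  equiv_reindex e (exists_betaRep κ hκ α β hαp hβp) fun w _ => beta_perm_eq e κ α β α' β' hα hβ w

end Summit.KontsevichZagierPeriods.TerasomaMultiplication.MultiplicationAccessible.MultGlue

namespace Summit.KontsevichZagierPeriods.TerasomaMultiplication.MultiplicationAccessible

open Literature.NumberTheory.Transcendental

/-- **Registered sub-goal `stub_multiplicativityGlue_part1` of stub `stub_multiplicativityGlue`**
(`∀`-form of `MultGlue.exists_betaRep`): Beta boxes `[(0,1)^N, κ ∏ᵢ zᵢ^(αᵢ−1)(1−zᵢ)^(βᵢ−1)]`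
with real algebraic `κ` and positive rational exponents are admissible integral representations.
[folklore] -/
theorem stub_multiplicativityGlue_part1 :
    ∀ (N : ℕ) (κ : ℝ), IsAlgebraic ℚ κ → ∀ (α β : Fin N → ℚ), (∀ i, 0 < α i) → (∀ i, 0 < β i) →
      ∃ r : KZ.IntegralRep N, r.domain = {z | ∀ i, z i ∈ Set.Ioo (0:ℝ) 1} ∧
        Set.EqOn r.integrand (fun z => κ * ∏ i,
          ((z i) ^ (((α i : ℚ) : ℝ) - 1) * (1 - z i) ^ (((β i : ℚ) : ℝ) - 1))) r.domain :=
  fun _ κ hκ α β hα hβ => MultGlue.exists_betaRep κ hκ α β hα hβ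

end Summit.KontsevichZagierPeriods.TerasomaMultiplication.MultiplicationAccessible

end
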